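import Summits.ResolutionOfSingularities.ResolutionOfSingularities.Theorems.PurelyInseparableDim4PhiLineFrameMoves
import Literature.AlgebraicGeometry.Resolution.IsolationIndexed
import Literature.AlgebraicGeometry.Resolution.PolygonChartTransportIndexed
import HarnessLib
import HarnessLib.Audit.Tags

/-!
# (K-Φ3) label propagation III: RE-CHOICE OF `u₂` — `u₂ ↦ a·u₂ + b·u₁ + Σ_j t_j y_j` with `a` a unit leaves the polygon's
# vertex data `pts ≠ ∅`, `αs`, `βs`, `δs` (hence `d! < δs`) unchanged when `αs > 0`
# (cell `res-dim4-pi`, K2(p) lane, slice C (5,3) route TAIL-B, residue (R2) of the B∞ assembly)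

[OURS · counted 0 · cell `res-dim4-pi` · K2(p) lane (holder res-dim4-p-12 g4, HOLDER WORD g4-2 2026-08-29T05:53Z «p-7 takes (R2) u₂
RE-CHOICE»; memo `SLICE-B-ARCH-g3.md` §17; res-dim4-idea-1 g7's residue list R1–R5 of the Φ = β_h line) · seat res-dim4-p-7 g4 ·
over res-dim4-p-11 g4's `…PhiLineVertexPerturbation` (`alphaS_betaS_eq_of_forall_sub_mem`) and `…PhiLineFrameMoves`
(`alphaS_/betaS_/deltaS_u2Shear` = the `b`-part).]  Nothing here proves K2(p)/K2(5), `NoAboveFloorTrap p p`, the β_h line or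
resolution of singularities in dimension ≥ 4 / characteristic `p`.  AI kernel work, weaker than expert review.

Setting: a regular local ring `R` of dimension `r + 2`, a regular system of parameters `c = (y₁, …, y_r, u₁, u₂) : Fin (r + 2) → R`,
an ideal `J ⊆ 𝔪^μ` with non-empty polygon `pts c J μ` (`Literature…PolygonInvariantsIndexed`).  The new frame `c′` is ANY family with
`c′_i = c_i` off `u₂` and the stated `u₂`-entry (DEF-FREE; instantiate with `Function.update` or a chart's own frame).
* §1 UNIT SCALING of one parameter (`c′_k = a·c_k`, `IsUnit a`; any index, any `σ`): every weighted order ideal is unchanged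
  (`weightedOrderIdeal_eq_of_unit_mul`), initial unit terms transfer (`isInitialTerm_of_unit_mul`: rescale the representative
  monomialwise by `a^{-m_k}`), hence `occ`, `pts` and ALL polygon invariants are literally equal (`pts_eq_of_unit_mul`,
  `alphaS_/betaS_/deltaS_eq_of_unit_mul`) — no hypothesis on `J`.
* §2 LIFTING `u₂` by parameters of higher weight (`c′_{u₂} = u₂ + b·u₁ + Σ_j t_j y_j`): `span_range_eq_of_u2Lift` (still a system of
  parameters), `weightedOrderIdeal_eq_of_u2Lift` (`F_ρ` unchanged for weights with `w_{u₂} ≤ w_{u₁}`, `w_{u₂} ≤ w_{y_j}`),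
  **`pts_nonempty_and_alphaS_betaS_eq_of_u2Lift`** (`αs > 0`: for the steep level weights through `v` of slope `N ≥ μ! + βs + 2`
  the `y_j` have weight `N·αs + βs > μ! = w_{u₂}` — a first-order perturbation, `alphaS_betaS_eq_of_forall_sub_mem`),
  **`deltaS_eq_of_u2Lift`** (no `αs > 0` needed: on the `δ`-line weight the `y_j` have weight `δs ≥ μ!`).
* §3 **`u2Rechoice_invariants`**: `c′_{u₂} = a·u₂ + b·u₁ + Σ t_j y_j`, `IsUnit a`, `J ⊆ 𝔪^μ`, `pts ≠ ∅`, `αs > 0` ⇒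
  `pts c′ ≠ ∅ ∧ αs′ = αs ∧ βs′ = βs ∧ δs′ = δs`; `factorial_lt_deltaS_u2Rechoice_iff` (`d! < δs` unchanged, `d = μ`).
* §4 res-dim4-idea-1 g7's binder shape (the move `u2Readapt c a b cy` unfolded as `Function.update c u₂ (…)`, no def):
  `pts_u2Readapt_nonempty_and_alphaS_betaS_eq`, `deltaS_u2Readapt`, `factorial_lt_deltaS_u2Readapt_iff`, **`readapt_binders`**.
[cite: CossartJannsenSaito2020, Lemma 13.6] [cite: CossartJannsenSaito2020, Thm. 8.16] [cite: CossartPiltant2008, proof of Lemma 4.5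
(2), pp. 11–12]
bears_on: LADDER-RESOLUTION:D157-DOOR2 (res-dim4-pi · K2(p) · slice C (5,3) TAIL-B · (R2)).  Supports
stmt-ResolutionOfSingularities-16155 (helper).
-/

noncomputable section

open IsLocalRing MvPolynomial
open Literature.AlgebraicGeometry.Resolution (weightedOrderIdeal weightedOrderIdeal_antitone apply_mem_weightedOrderIdeal)
open Literature.AlgebraicGeometry.Resolution.WeightedOrder

set_option linter.dupNamespace false

namespace Summit.ResolutionOfSingularities.ResolutionOfSingularities.Theorems.PIDim4.PhiLine

universe u v

/-! ## §1 Unit scaling of one parameter -/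

section Scale

variable {R : Type u} [CommRing R] {σ : Type v} {c c' : σ → R} {k : σ} {a : R}

/-- The inverse relation: `c_k = a⁻¹ · c′_k`. [cite: CossartJannsenSaito2020, Def. 7.2 (1)] -/
theorem apply_eq_inv_mul_of_unit_mul (hk : c' k = a * c k) (u : Rˣ) (hu : (u : R) = a) : c k = ↑u⁻¹ * c' k := by
  rw [hk, ← hu, ← mul_assoc, Units.inv_mul, one_mul]

/-- **`c_k ↦ a·c_k` with `a` a unit changes no weighted order ideal.** [cite: CossartJannsenSaito2020, Def. 7.2 (1)] -/
theorem weightedOrderIdeal_eq_of_unit_mul (hc' : ∀ i, i ≠ k → c' i = c i) (hk : c' k = a * c k) (ha : IsUnit a)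
    (w : σ → ℕ) (ρ : ℕ) : weightedOrderIdeal c' w ρ = weightedOrderIdeal c w ρ := by
  obtain ⟨u, hu⟩ := ha
  refine weightedOrderIdeal_eq_of_forall_apply_mem c c' w (fun i => ?_) (fun i => ?_) ρ
  · by_cases hi : i = k
    · subst hi; rw [hk]; exact Ideal.mul_mem_left _ _ (apply_mem_weightedOrderIdeal c w i)
    · rw [hc' i hi]; exact apply_mem_weightedOrderIdeal c w i
  · by_cases hi : i = k
    · subst hi; rw [apply_eq_inv_mul_of_unit_mul hk u hu]; exact Ideal.mul_mem_left _ _ (apply_mem_weightedOrderIdeal c' w i)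
    · rw [← hc' i hi]; exact apply_mem_weightedOrderIdeal c' w i

variable [Fintype σ] [DecidableEq σ]

/-- **Initial unit terms survive the unit scaling `c_k ↦ a·c_k`**: rescale the homogeneous representative `F` monomialwise by
`(a⁻¹)^{m_k}`; its value at the new system is `F(c)`, its coefficient at `e` is still a unit. [cite: CossartJannsenSaito2020, Def. 8.2] -/
theorem isInitialTerm_of_unit_mul (hc' : ∀ i, i ≠ k → c' i = c i) (hk : c' k = a * c k) (ha : IsUnit a) {w : σ → ℕ} {f : R}
    {e : σ →₀ ℕ} (he : IsInitialTerm c w f e) : IsInitialTerm c' w f e := by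
  classical
  obtain ⟨u, hu⟩ := ha
  obtain ⟨F, hF, hunit, hrem⟩ := he
  -- the scaling factors `β_i` (`a⁻¹` at `k`, `1` elsewhere) and the rescaled representative
  set β : σ → R := fun i => if i = k then ↑u⁻¹ else 1 with hβ
  set F' : MvPolynomial σ R := ∑ d ∈ F.support, monomial d (coeff d F * ∏ i, β i ^ d i) with hF'
  have hcoeff : ∀ m, coeff m F' = coeff m F * ∏ i, β i ^ m i := by
    intro m
    rw [hF', coeff_sum]
    simp_rw [coeff_monomial]
    rw [Finset.sum_ite_eq']
    split_ifs with hm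
    · rfl
    · rw [notMem_support_iff.mp hm, zero_mul]
  have hβc : ∀ i, β i * c' i = c i := by
    intro i
    by_cases hi : i = k
    · subst hi; rw [hβ]; simp only [if_true]; rw [apply_eq_inv_mul_of_unit_mul hk u hu]
    · rw [hβ]; simp only [if_neg hi, one_mul]; exact hc' i hi
  have heval : eval c' F' = eval c F := by
    rw [hF', map_sum, eval_eq' c F]
    refine Finset.sum_congr rfl fun d _ => ?_
    rw [eval_monomial, Finsupp.prod_pow, mul_assoc, ← Finset.prod_mul_distrib]
    congr 1
    refine Finset.prod_congr rfl fun i _ => ?_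
    rw [← mul_pow, hβc]
  refine ⟨F', fun d hd => hF ?_, ?_, ?_⟩
  · rw [hcoeff] at hd; exact left_ne_zero_of_mul hd
  · rw [hcoeff]
    exact hunit.mul (IsUnit.prod_iff.mpr fun i _ => by
      by_cases hi : i = k
      · subst hi; rw [hβ]; simp only [if_true]; exact (Units.isUnit u⁻¹).pow _
      · rw [hβ]; simp only [if_neg hi, one_pow]; exact isUnit_one)
  · rw [heval, weightedOrderIdeal_eq_of_unit_mul hc' hk ⟨u, hu⟩]; exact hrem

/-- The Newton point sets of `c` and `c′` coincide. [cite: CossartJannsenSaito2020, Def. 8.5 (4)] -/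
theorem occ_eq_of_unit_mul (hc' : ∀ i, i ≠ k → c' i = c i) (hk : c' k = a * c k) (ha : IsUnit a) (J : Ideal R) :
    occ c' J = occ c J := by
  obtain ⟨u, hu⟩ := ha
  refine Set.Subset.antisymm (fun e ⟨f, hf, w, hw, he⟩ => ⟨f, hf, w, hw, ?_⟩) (fun e ⟨f, hf, w, hw, he⟩ => ⟨f, hf, w, hw, ?_⟩)
  · exact isInitialTerm_of_unit_mul (c := c') (c' := c) (k := k) (fun i hi => (hc' i hi).symm)
      (apply_eq_inv_mul_of_unit_mul hk u hu) (Units.isUnit u⁻¹) he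
  · exact isInitialTerm_of_unit_mul hc' hk ⟨u, hu⟩ he

end Scale

section ScalePolygon

variable {R : Type u} [CommRing R] {r : ℕ} {c c' : Fin (r + 2) → R} {k : Fin (r + 2)} {a : R}
  (hc' : ∀ i, i ≠ k → c' i = c i) (hk : c' k = a * c k) (ha : IsUnit a) (J : Ideal R) (μ : ℕ)

include hc' hk ha in
/-- **The polygon's point set is unchanged by `c_k ↦ a·c_k`.** [cite: CossartJannsenSaito2020, Def. 11.1] -/
theorem pts_eq_of_unit_mul : pts c' J μ = pts c J μ := by
  ext e; simp only [pts, Set.mem_setOf_eq, occ_eq_of_unit_mul hc' hk ha J]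

include hc' hk ha in
/-- `α` under unit scaling. [cite: CossartJannsenSaito2020, Def. 11.1] -/
theorem alphaS_eq_of_unit_mul : alphaS c' J μ = alphaS c J μ := by
  unfold alphaS; rw [pts_eq_of_unit_mul hc' hk ha J μ]

include hc' hk ha in
/-- `β` under unit scaling. [cite: CossartJannsenSaito2020, Def. 11.1] -/
theorem betaS_eq_of_unit_mul : betaS c' J μ = betaS c J μ := by
  unfold betaS; rw [pts_eq_of_unit_mul hc' hk ha J μ, alphaS_eq_of_unit_mul hc' hk ha J μ]

include hc' hk ha in
/-- `δ` under unit scaling. [cite: CossartJannsenSaito2020, Def. 11.1] -/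
theorem deltaS_eq_of_unit_mul : deltaS c' J μ = deltaS c J μ := by
  unfold deltaS; rw [pts_eq_of_unit_mul hc' hk ha J μ]

end ScalePolygon

/-! ## §2 Lifting `u₂` by parameters of higher weight: `c′_{u₂} = u₂ + b·u₁ + Σ_j t_j y_j` -/

section Lift

variable {R : Type u} [CommRing R] {r : ℕ}

/-! `u1_ne_u2` / `castAdd_ne_u2` are the tree's (`…PolygonChartTransportIndexed`, `…IsolationIndexed`). -/

variable {c c' : Fin (r + 2) → R} {b : R} {t : Fin r → R} (hc' : ∀ i, i ≠ u2 r → c' i = c i)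
  (hu2 : c' (u2 r) = c (u2 r) + b * c (u1 r) + ∑ j, t j * c (Fin.castAdd 2 j))

include hc' hu2 in
/-- **The lift is undone by a lift of the same shape** (`u₁`, `y_j` are unchanged): `c_{u₂} = c′_{u₂} + (−b)·c′_{u₁} + Σ (−t_j)·c′_{y_j}`.
[cite: CossartJannsenSaito2020, Lemma 13.6] -/
theorem u2Lift_symm : c (u2 r) = c' (u2 r) + (-b) * c' (u1 r) + ∑ j, (-t j) * c' (Fin.castAdd 2 j) := by
  rw [hu2, hc' _ u1_ne_u2]
  simp_rw [hc' _ (castAdd_ne_u2 _), neg_mul, Finset.sum_neg_distrib]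
  ring

/-- One direction of `weightedOrderIdeal_eq_of_u2Lift`: every `c′_i` has the weight of `c_i`. [cite: CossartJannsenSaito2020, Lemma 13.6] -/
theorem apply_mem_of_u2Lift {c c' : Fin (r + 2) → R} {b : R} {t : Fin r → R} (hc' : ∀ i, i ≠ u2 r → c' i = c i)
    (hu2 : c' (u2 r) = c (u2 r) + b * c (u1 r) + ∑ j, t j * c (Fin.castAdd 2 j)) (w : Fin (r + 2) → ℕ)
    (hw1 : w (u2 r) ≤ w (u1 r)) (hwy : ∀ j, w (u2 r) ≤ w (Fin.castAdd 2 j)) (i : Fin (r + 2)) :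
    c' i ∈ weightedOrderIdeal c w (w i) := by
  by_cases hi : i = u2 r
  · subst hi
    rw [hu2]
    refine Ideal.add_mem _ (Ideal.add_mem _ (apply_mem_weightedOrderIdeal c w _)
      (Ideal.mul_mem_left _ _ (weightedOrderIdeal_antitone c w hw1 (apply_mem_weightedOrderIdeal c w (u1 r)))))
      (Ideal.sum_mem _ fun j _ => Ideal.mul_mem_left _ _
        (weightedOrderIdeal_antitone c w (hwy j) (apply_mem_weightedOrderIdeal c w (Fin.castAdd 2 j))))
  · rw [hc' i hi]; exact apply_mem_weightedOrderIdeal c w i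

include hc' hu2 in
/-- **The lift does not change `F_ρ` when `w_{u₂} ≤ w_{u₁}` and `w_{u₂} ≤ w_{y_j}` for all `j`.**
[cite: CossartJannsenSaito2020, Lemma 13.6] [cite: CossartJannsenSaito2020, Thm. 8.16] -/
theorem weightedOrderIdeal_eq_of_u2Lift (w : Fin (r + 2) → ℕ) (hw1 : w (u2 r) ≤ w (u1 r))
    (hwy : ∀ j, w (u2 r) ≤ w (Fin.castAdd 2 j)) (ρ : ℕ) : weightedOrderIdeal c' w ρ = weightedOrderIdeal c w ρ :=
  weightedOrderIdeal_eq_of_forall_apply_mem c c' w (apply_mem_of_u2Lift hc' hu2 w hw1 hwy)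
    (apply_mem_of_u2Lift (fun i hi => (hc' i hi).symm) (u2Lift_symm hc' hu2) w hw1 hwy) ρ

/-- One direction of `span_range_eq_of_u2Lift`. [cite: CossartJannsenSaito2020, Def. 8.2] -/
theorem span_range_le_of_u2Lift {c c' : Fin (r + 2) → R} {b : R} {t : Fin r → R} (hc' : ∀ i, i ≠ u2 r → c' i = c i)
    (hu2 : c' (u2 r) = c (u2 r) + b * c (u1 r) + ∑ j, t j * c (Fin.castAdd 2 j)) :
    Ideal.span (Set.range c') ≤ Ideal.span (Set.range c) := by
  rw [Ideal.span_le]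
  rintro _ ⟨i, rfl⟩
  by_cases hi : i = u2 r
  · subst hi
    rw [SetLike.mem_coe, hu2]
    exact Ideal.add_mem _ (Ideal.add_mem _ (Ideal.subset_span ⟨_, rfl⟩) (Ideal.mul_mem_left _ _ (Ideal.subset_span ⟨_, rfl⟩)))
      (Ideal.sum_mem _ fun j _ => Ideal.mul_mem_left _ _ (Ideal.subset_span ⟨_, rfl⟩))
  · rw [SetLike.mem_coe, hc' i hi]; exact Ideal.subset_span ⟨i, rfl⟩

include hc' hu2 in
/-- **The lifted system generates the same ideal** (`u₂ ↦ u₂ + (element of (u₁, y))`). [cite: CossartJannsenSaito2020, Def. 8.2] -/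
theorem span_range_eq_of_u2Lift : Ideal.span (Set.range c') = Ideal.span (Set.range c) :=
  le_antisymm (span_range_le_of_u2Lift hc' hu2)
    (span_range_le_of_u2Lift (fun i hi => (hc' i hi).symm) (u2Lift_symm hc' hu2))

variable [IsRegularLocalRing R] (hgen : Ideal.span (Set.range c) = maximalIdeal R) (hdim : ringKrullDim R = r + 2)
  {J : Ideal R} {μ : ℕ}

include hc' hu2 hgen hdim in
/-- **The vertex is unchanged by the lift when `αs > 0`**: the polygon of `c′` is non-empty with the same `αs`, `βs`
(`J ⊆ 𝔪^μ`, non-empty polygon) — instance of `alphaS_betaS_eq_of_forall_sub_mem` with threshold `N₀ = μ! + βs + 2`: for the steep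
weights `(Nαs + βs, …, μ! N, μ!)`, `N ≥ N₀`, both `u₁` and the `y_j` (`αs ≥ 1`) have weight `> μ! = w_{u₂}`.
[cite: CossartJannsenSaito2020, Lemma 13.6] [cite: CossartJannsenSaito2020, Thm. 8.16] -/
theorem pts_nonempty_and_alphaS_betaS_eq_of_u2Lift (hJμ : J ≤ maximalIdeal R ^ μ) (hne : (pts c J μ).Nonempty)
    (hα : 0 < alphaS c J μ) : (pts c' J μ).Nonempty ∧ alphaS c' J μ = alphaS c J μ ∧ betaS c' J μ = betaS c J μ := by
  have hL := Nat.factorial_pos μ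
  have hwts : ∀ N, μ.factorial + betaS c J μ + 2 ≤ N →
      levelWeight (r := r) μ (N * alphaS c J μ + betaS c J μ) N 1 (u2 r) + 1 ≤
        levelWeight (r := r) μ (N * alphaS c J μ + betaS c J μ) N 1 (u1 r) ∧
      ∀ j, levelWeight (r := r) μ (N * alphaS c J μ + betaS c J μ) N 1 (u2 r) + 1 ≤
        levelWeight (r := r) μ (N * alphaS c J μ + betaS c J μ) N 1 (Fin.castAdd 2 j) := by
    intro N hN
    refine ⟨?_, fun j => ?_⟩
    · rw [levelWeight_u1, levelWeight_u2]; nlinarith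
    · rw [levelWeight_y, levelWeight_u2]; nlinarith
  refine alphaS_betaS_eq_of_forall_sub_mem c c' hgen hdim (by rw [span_range_eq_of_u2Lift hc' hu2, hgen]) hJμ hne
    (N₀ := μ.factorial + betaS c J μ + 2) (by omega)
    (fun N hN ρ => weightedOrderIdeal_eq_of_u2Lift hc' hu2 _ (Nat.le_of_succ_le (hwts N hN).1)
      (fun j => Nat.le_of_succ_le ((hwts N hN).2 j)) ρ) (fun i => ?_)
  by_cases hi : i = u2 r
  · subst hi
    rw [hu2]
    have hsplit : c (u2 r) - (c (u2 r) + b * c (u1 r) + ∑ j, t j * c (Fin.castAdd 2 j)) =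
        -(b * c (u1 r) + ∑ j, t j * c (Fin.castAdd 2 j)) := by ring
    rw [hsplit]
    obtain ⟨h1, hy⟩ := hwts _ le_rfl
    exact Submodule.neg_mem _ (Ideal.add_mem _
      (Ideal.mul_mem_left _ _ (weightedOrderIdeal_antitone c _ h1 (apply_mem_weightedOrderIdeal c _ (u1 r))))
      (Ideal.sum_mem _ fun j _ => Ideal.mul_mem_left _ _
        (weightedOrderIdeal_antitone c _ (hy j) (apply_mem_weightedOrderIdeal c _ (Fin.castAdd 2 j)))))
  · rw [hc' i hi, sub_self]; exact Ideal.zero_mem _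

include hdim in
/-- One inequality of `deltaS_eq_of_u2Lift`, for an arbitrary lift pair. [cite: CossartJannsenSaito2020, Lemma 8.4] -/
theorem deltaS_le_of_u2Lift {c c' : Fin (r + 2) → R} {b : R} {t : Fin r → R} (hc' : ∀ i, i ≠ u2 r → c' i = c i)
    (hu2 : c' (u2 r) = c (u2 r) + b * c (u1 r) + ∑ j, t j * c (Fin.castAdd 2 j))
    (hgen : Ideal.span (Set.range c) = maximalIdeal R) (hJμ : J ≤ maximalIdeal R ^ μ) (hne : (pts c J μ).Nonempty)
    (hne' : (pts c' J μ).Nonempty) : deltaS c J μ ≤ deltaS c' J μ := by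
  have hδL : μ.factorial ≤ deltaS c J μ := by
    obtain ⟨e₀, he₀, h₀⟩ := exists_pts_deltaS hne
    have := factorial_le_spt_add c hgen hdim hJμ he₀
    omega
  have hδpos : 0 < deltaS c J μ := lt_of_lt_of_le (Nat.factorial_pos μ) hδL
  have h1 := (le_weightedOrderIdeal_levelWeight_iff c hgen hdim J hδpos Nat.one_pos Nat.one_pos).mpr
    (fun e he => by simpa using deltaS_le he)
  rw [← weightedOrderIdeal_eq_of_u2Lift hc' hu2 (levelWeight μ (deltaS c J μ) 1 1)
    (by rw [levelWeight_u1, levelWeight_u2]) (fun j => by rw [levelWeight_y, levelWeight_u2, mul_one]; exact hδL)] at h1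
  have h2 := (le_weightedOrderIdeal_levelWeight_iff c' (by rw [span_range_eq_of_u2Lift hc' hu2, hgen]) hdim J hδpos
    Nat.one_pos Nat.one_pos).mp h1
  obtain ⟨e, he, hsum⟩ := exists_pts_deltaS hne'
  have := h2 e he
  rw [← hsum]; omega

include hc' hu2 hgen hdim in
/-- **`δ` is unchanged by the lift** (for the `δ`-line weight `(δs, …, δs, μ!, μ!)` the `y_j` have weight `δs ≥ μ!` and `u₁`
weight `μ!`, so the weighted order ideals agree; one inequality for an arbitrary lift, then lift back).
[cite: CossartJannsenSaito2020, Lemma 13.6] [cite: CossartJannsenSaito2020, Lemma 8.4] -/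
theorem deltaS_eq_of_u2Lift (hJμ : J ≤ maximalIdeal R ^ μ) (hne : (pts c J μ).Nonempty) (hne' : (pts c' J μ).Nonempty) :
    deltaS c' J μ = deltaS c J μ :=
  le_antisymm
    (deltaS_le_of_u2Lift hdim (fun i hi => (hc' i hi).symm) (u2Lift_symm hc' hu2)
      (by rw [span_range_eq_of_u2Lift hc' hu2, hgen]) hJμ hne' hne)
    (deltaS_le_of_u2Lift hdim hc' hu2 hgen hJμ hne hne')

end Lift

/-! ## §3 The re-choice `u₂ ↦ a·u₂ + b·u₁ + Σ_j t_j y_j` -/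

section Rechoice

variable {R : Type u} [CommRing R] [IsRegularLocalRing R] {r : ℕ} {c c' : Fin (r + 2) → R}
  (hgen : Ideal.span (Set.range c) = maximalIdeal R) (hdim : ringKrullDim R = r + 2) {J : Ideal R} {μ : ℕ}

include hgen hdim in
/-- **RE-CHOICE OF `u₂` (residue (R2) of the B∞ assembly).**  For `c′` with `c′_i = c_i` off `u₂` and
`c′_{u₂} = a·u₂ + b·u₁ + Σ_j t_j y_j`, `a` a unit, `J ⊆ 𝔪^μ`, non-empty polygon and `αs > 0`: the polygon of `c′` is non-empty
and `αs`, `βs`, `δs` are those of `c` (lift by `a⁻¹b`, `a⁻¹t`, then scale `u₂` by `a`).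
[cite: CossartJannsenSaito2020, Lemma 13.6] [cite: CossartJannsenSaito2020, Thm. 8.16] -/
theorem u2Rechoice_invariants (hJμ : J ≤ maximalIdeal R ^ μ) (hne : (pts c J μ).Nonempty) (hα : 0 < alphaS c J μ)
    {a b : R} {t : Fin r → R} (ha : IsUnit a) (hc' : ∀ i, i ≠ u2 r → c' i = c i)
    (hu2 : c' (u2 r) = a * c (u2 r) + b * c (u1 r) + ∑ j, t j * c (Fin.castAdd 2 j)) :
    (pts c' J μ).Nonempty ∧ alphaS c' J μ = alphaS c J μ ∧ betaS c' J μ = betaS c J μ ∧ deltaS c' J μ = deltaS c J μ := by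
  classical
  obtain ⟨u, hu⟩ := ha
  -- the intermediate lifted system `c₁`
  set c₁ : Fin (r + 2) → R :=
    Function.update c (u2 r) (c (u2 r) + (↑u⁻¹ * b) * c (u1 r) + ∑ j, (↑u⁻¹ * t j) * c (Fin.castAdd 2 j)) with hc₁
  have hc₁i : ∀ i, i ≠ u2 r → c₁ i = c i := fun i hi => by rw [hc₁, Function.update_of_ne hi]
  have hc₁u : c₁ (u2 r) = c (u2 r) + (↑u⁻¹ * b) * c (u1 r) + ∑ j, (↑u⁻¹ * t j) * c (Fin.castAdd 2 j) := by
    rw [hc₁, Function.update_self]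
  have hc'₁ : ∀ i, i ≠ u2 r → c' i = c₁ i := fun i hi => by rw [hc' i hi, hc₁i i hi]
  have hk : c' (u2 r) = a * c₁ (u2 r) := by
    rw [hu2, hc₁u, ← hu, mul_add, mul_add, Finset.mul_sum]
    congr 1
    · congr 1; rw [← mul_assoc, ← mul_assoc, Units.mul_inv, one_mul]
    · refine Finset.sum_congr rfl fun j _ => ?_
      rw [← mul_assoc, ← mul_assoc, Units.mul_inv, one_mul]
  obtain ⟨hne₁, hα₁, hβ₁⟩ := pts_nonempty_and_alphaS_betaS_eq_of_u2Lift hc₁i hc₁u hgen hdim hJμ hne hα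
  have hδ₁ := deltaS_eq_of_u2Lift hc₁i hc₁u hgen hdim hJμ hne hne₁
  rw [pts_eq_of_unit_mul hc'₁ hk ⟨u, hu⟩ J μ, alphaS_eq_of_unit_mul hc'₁ hk ⟨u, hu⟩ J μ,
    betaS_eq_of_unit_mul hc'₁ hk ⟨u, hu⟩ J μ, deltaS_eq_of_unit_mul hc'₁ hk ⟨u, hu⟩ J μ]
  exact ⟨hne₁, hα₁, hβ₁, hδ₁⟩

include hgen hdim in
/-- `d! < δs` (`d = μ`) is unchanged by the re-choice of `u₂`. [cite: CossartJannsenSaito2020, Lemma 13.6] -/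
theorem factorial_lt_deltaS_u2Rechoice_iff (hJμ : J ≤ maximalIdeal R ^ μ) (hne : (pts c J μ).Nonempty)
    (hα : 0 < alphaS c J μ) {a b : R} {t : Fin r → R} (ha : IsUnit a) (hc' : ∀ i, i ≠ u2 r → c' i = c i)
    (hu2 : c' (u2 r) = a * c (u2 r) + b * c (u1 r) + ∑ j, t j * c (Fin.castAdd 2 j)) :
    μ.factorial < deltaS c' J μ ↔ μ.factorial < deltaS c J μ := by
  rw [(u2Rechoice_invariants hgen hdim hJμ hne hα ha hc' hu2).2.2.2]

end Rechoice


/-! ## §4 res-dim4-idea-1 g7's binder shape (2026-08-29T05:57Z): the move `u2Readapt c a b cy` UNFOLDED as `Function.update` -/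

section Readapt

variable {R : Type u} [CommRing R] [IsRegularLocalRing R] {r : ℕ} (c : Fin (r + 2) → R)
  (hgen : Ideal.span (Set.range c) = maximalIdeal R) (hdim : ringKrullDim R = r + 2) {J : Ideal R} {μ : ℕ}
  (hJμ : J ≤ maximalIdeal R ^ μ) (hne : (pts c J μ).Nonempty) (a b : R) (cy : Fin r → R)

include hgen hdim hJμ hne in
/-- **(i)** The re-adapted frame `(y, u₁, a·u₂ + b·u₁ + Σ cy_j y_j)` (`a` a unit, `αs > 0`) has a non-empty polygon with the same
`αs`, `βs`. [cite: CossartJannsenSaito2020, Lemma 13.6] [cite: CossartJannsenSaito2020, Thm. 8.16] -/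
theorem pts_u2Readapt_nonempty_and_alphaS_betaS_eq (ha : IsUnit a) (hα : 0 < alphaS c J μ) :
    (pts (Function.update c (u2 r) (a * c (u2 r) + b * c (u1 r) + ∑ j, cy j * c (Fin.castAdd 2 j))) J μ).Nonempty ∧
      alphaS (Function.update c (u2 r) (a * c (u2 r) + b * c (u1 r) + ∑ j, cy j * c (Fin.castAdd 2 j))) J μ = alphaS c J μ ∧
      betaS (Function.update c (u2 r) (a * c (u2 r) + b * c (u1 r) + ∑ j, cy j * c (Fin.castAdd 2 j))) J μ = betaS c J μ := by
  obtain ⟨h1, h2, h3, -⟩ := u2Rechoice_invariants hgen hdim hJμ hne hα ha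
    (fun _ hi => Function.update_of_ne hi _ c) (Function.update_self (u2 r) _ c)
  exact ⟨h1, h2, h3⟩

include hgen hdim hJμ hne in
/-- **(ii)** `δ` of the re-adapted frame equals `δ` (equality, not only `μ! < δ`). [cite: CossartJannsenSaito2020, Lemma 13.6] -/
theorem deltaS_u2Readapt (ha : IsUnit a) (hα : 0 < alphaS c J μ) :
    deltaS (Function.update c (u2 r) (a * c (u2 r) + b * c (u1 r) + ∑ j, cy j * c (Fin.castAdd 2 j))) J μ = deltaS c J μ :=
  (u2Rechoice_invariants hgen hdim hJμ hne hα ha (fun _ hi => Function.update_of_ne hi _ c) (Function.update_self (u2 r) _ c)).2.2.2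

include hgen hdim hJμ hne in
/-- **(ii′)** `μ! < δs` transfers to the re-adapted frame. [cite: CossartJannsenSaito2020, Lemma 13.6] -/
theorem factorial_lt_deltaS_u2Readapt_iff (ha : IsUnit a) (hα : 0 < alphaS c J μ) :
    μ.factorial < deltaS (Function.update c (u2 r) (a * c (u2 r) + b * c (u1 r) + ∑ j, cy j * c (Fin.castAdd 2 j))) J μ ↔
      μ.factorial < deltaS c J μ := by
  rw [deltaS_u2Readapt c hgen hdim hJμ hne a b cy ha hα]

include hgen hdim hJμ hne in
/-- **(iii) The step-law binders for the re-adapted frame**: `pts′ ≠ ∅`, `μ! < δs′`, `αs′ < μ!` and `βs′ = βs` follow from the same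
facts for `c` (`a` a unit, `αs > 0`). [cite: CossartJannsenSaito2020, Lemma 13.6] [cite: CossartJannsenSaito2020, Thm. 8.16] -/
theorem readapt_binders (ha : IsUnit a) (hα : 0 < alphaS c J μ) (hδ : μ.factorial < deltaS c J μ)
    (hαμ : alphaS c J μ < μ.factorial) :
    (pts (Function.update c (u2 r) (a * c (u2 r) + b * c (u1 r) + ∑ j, cy j * c (Fin.castAdd 2 j))) J μ).Nonempty ∧
      μ.factorial < deltaS (Function.update c (u2 r) (a * c (u2 r) + b * c (u1 r) + ∑ j, cy j * c (Fin.castAdd 2 j))) J μ ∧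
      alphaS (Function.update c (u2 r) (a * c (u2 r) + b * c (u1 r) + ∑ j, cy j * c (Fin.castAdd 2 j))) J μ < μ.factorial ∧
      betaS (Function.update c (u2 r) (a * c (u2 r) + b * c (u1 r) + ∑ j, cy j * c (Fin.castAdd 2 j))) J μ = betaS c J μ := by
  obtain ⟨h1, h2, h3, h4⟩ := u2Rechoice_invariants hgen hdim hJμ hne hα ha
    (fun _ hi => Function.update_of_ne hi _ c) (Function.update_self (u2 r) _ c)
  exact ⟨h1, by rw [h4]; exact hδ, by rw [h2]; exact hαμ, h3⟩

end Readapt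

end Summit.ResolutionOfSingularities.ResolutionOfSingularities.Theorems.PIDim4.PhiLine

end
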